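import Literature.IUT.HodgeTheaters.ThetaHodgeTheaters
import HarnessLib

/-!
# [IUTchI] Corollaries 3.8, 3.9: the Frobenius-picture and the étale-picture of Θ-Hodge theaters

S. Mochizuki, *Inter-universal Teichmüller theory I*, §3, Corollary 3.8 (p. 89) and Corollary 3.9
(pp. 91–92), over the interface and Cor. 3.7 of `ThetaHodgeTheaters.lean`
[claim: Mochizuki2012, status: disputed]. DEFINITIONS, `Prop`-valued statements, and the formal
consequences among them PROVED; nothing of the text is asserted.

* Cor. 3.8 (Frobenius-picture): "a collection of distinct Θ-Hodge theaters `{ⁿHT^Θ}_{n∈ℤ}`"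
  Θ-linked in an infinite chain `… ⟶^Θ ⁽ⁿ⁻¹⁾HT^Θ ⟶^Θ ⁿHT^Θ ⟶^Θ ⁽ⁿ⁺¹⁾HT^Θ ⟶^Θ …`, with its
  translation symmetry (`FrobeniusPicture`, `link`, `shift`).
* Cor. 3.9 (i) (étale-picture): the `ⁿD_v` all standing in the relationship "— —" to the coric
  `D⊢_v` (Rmk 3.8.1 (ii): "one may regard `⁽⁻⁾D⊢_v` as a sort of constant invariant"); TYPED as the
  poly-isomorphisms between the `ⁿD⊢_v` GENERATED by composing the composite poly-isomorphisms
  `ⁿD⊢_v ⥲ ⁽ⁿ⁺¹⁾D⊢_v` of Cor. 3.7 (ii) (the edges of the chain) and their inverses (`ChainGen`,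
  `etalePicture`). "The étale-picture … admits arbitrary permutation symmetries among the labels
  `n ∈ ℤ`" is the `Prop` `EtalePermutationSymmetric` (relabelling the chain by `σ ∈ Perm ℤ` does not
  change the generated poly-isomorphisms). PROVED: if the edges are full (the bracketed "[full]" of
  Cor. 3.7 (ii), `ThetaLinkBaseFull`) then the étale-picture is full (`etalePicture_full`) and hence
  permutation-symmetric (`etalePermutationSymmetric_of_full`) — the text's "canonical splitting".
* Cor. 3.9 (ii) (étale-picture plus units): the same with the pairs "`D⊢_v ↷ 𝒪^×_{C⊢_v}`", edges =
  the pair poly-isomorphisms of Cor. 3.7 (ii)+(iii) (`thetaLinkPair`; the product groupoid records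
  the two components side by side — "`𝒪^×` ON `D⊢_v`" is not a functor of the interface).
-/

namespace Literature.IUT.HodgeTheaters

open CategoryTheory

universe u v w uM

/-! ### Poly-isomorphisms generated by a chain -/

section Chain

variable {𝒞 : Type*} [Category 𝒞] (X : ℤ → 𝒞) (edge : ∀ n : ℤ, PolyIso (X n) (X (n + 1)))

/-- The poly-isomorphisms GENERATED by a `ℤ`-indexed chain of poly-isomorphisms
`edge n : X n ⥲ X (n+1)`: all composites of members of the edges and of their inverses
(the smallest family containing the edges and closed under identities, inverses, composition).
[claim: Mochizuki2012, status: disputed] -/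
inductive ChainGen : ∀ a b : ℤ, (X a ≅ X b) → Prop
  | ofEdge {c : ℤ} {g : X c ≅ X (c + 1)} : g ∈ edge c → ChainGen c (c + 1) g
  | refl (a : ℤ) : ChainGen a a (Iso.refl _)
  | symm {a b : ℤ} {f : X a ≅ X b} : ChainGen a b f → ChainGen b a f.symm
  | trans {a b c : ℤ} {f : X a ≅ X b} {g : X b ≅ X c} :
      ChainGen a b f → ChainGen b c g → ChainGen a c (f ≪≫ g)

/-- The generated poly-isomorphism `X a ⥲ X b`. [claim: Mochizuki2012, status: disputed] -/
def chainPolyIso (a b : ℤ) : PolyIso (X a) (X b) := {f | ChainGen X edge a b f}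

variable {X edge}

/-- If every edge is the FULL poly-isomorphism and is nonempty, every generated poly-isomorphism is
full (first all automorphisms of `X a`, then induction along the chain) — PROVED.
[claim: Mochizuki2012, status: disputed] -/
theorem chainPolyIso_eq_full (hfull : ∀ n, edge n = PolyIso.full (X n) (X (n + 1)))
    (hne : ∀ n, (edge n).Nonempty) (a b : ℤ) : chainPolyIso X edge a b = PolyIso.full (X a) (X b) := by
  -- every automorphism of `X a` is generated: `h = (h ≫ g) ≫ g⁻¹` with `h ≫ g`, `g` in the full edge
  have aut : ∀ (a : ℤ) (h : X a ≅ X a), ChainGen X edge a a h := by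
    intro a h
    obtain ⟨g, hg⟩ := hne a
    have hg' : h ≪≫ g ∈ edge a := by rw [hfull]; trivial
    have := ChainGen.trans (ChainGen.ofEdge hg') (ChainGen.symm (ChainGen.ofEdge hg))
    simpa using this
  -- forward along the chain
  have fwd : ∀ (a b : ℤ), a ≤ b → ∀ f : X a ≅ X b, ChainGen X edge a b f := by
    intro a b hab
    induction b, hab using Int.leInduction with
    | base => exact aut a
    | succ n hmn ih =>
        intro f
        obtain ⟨g, hg⟩ := hne n
        have := ChainGen.trans (ih (f ≪≫ g.symm)) (ChainGen.ofEdge hg)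
        simpa using this
  ext f
  simp only [chainPolyIso, Set.mem_setOf_eq, PolyIso.full, Set.mem_univ, iff_true]
  rcases le_total a b with hab | hba
  · exact fwd a b hab f
  · simpa using ChainGen.symm (fwd b a hba f.symm)

end Chain

/-! ### Corollary 3.8: the Frobenius-picture -/

section Pictures

variable {F : Type u} {K : Type v} {Fbar : Type w} [Field F] [NumberField F] [Field K]
  [NumberField K] [Algebra F K] [Field Fbar] [Algebra F Fbar] [Algebra K Fbar]
  {E : WeierstrassCurve F} [E.IsElliptic] {l : ℕ} {P : BadPlacePredicates K}
  {D : InitialThetaData F K Fbar E l P}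

/-- **Corollary 3.8** (p. 89), the **Frobenius-picture**: "a collection of distinct Θ-Hodge theaters
`{ⁿHT^Θ}_{n ∈ ℤ}` indexed by the integers", Θ-linked in an infinite chain
`… ⟶^Θ ⁽ⁿ⁻¹⁾HT^Θ ⟶^Θ ⁿHT^Θ ⟶^Θ ⁽ⁿ⁺¹⁾HT^Θ ⟶^Θ …` (the links are the canonical full
poly-isomorphisms `FrobeniusPicture.link`; "distinct" = distinct labels).
[claim: Mochizuki2012, status: disputed] -/
structure FrobeniusPicture (M : HodgeTheaterModel D) where
  /-- `n ↦ ⁿHT^Θ` -/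
  HT : ℤ → ThetaHodgeTheater M

namespace FrobeniusPicture

variable {M : HodgeTheaterModel D} (Fr : FrobeniusPicture M)

/-- The `n`-th Θ-link `ⁿHT^Θ ⟶^Θ ⁽ⁿ⁺¹⁾HT^Θ` of the chain (Cor. 3.8, applying Cor. 3.7 (i) with
`† = n`, `‡ = n + 1`). [claim: Mochizuki2012, status: disputed] -/
def link (n : ℤ) : PolyIso (Fr.HT n).Ftht (Fr.HT (n + 1)).glob := (Fr.HT n).thetaLink (Fr.HT (n + 1))

/-- Cor. 3.8: "this oriented graph `Γ⃗` admits a natural action by `ℤ` — i.e., a translation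
symmetry": shifting the labels. [claim: Mochizuki2012, status: disputed] -/
def shift (k : ℤ) : FrobeniusPicture M := ⟨fun n => Fr.HT (n + k)⟩

/-- Relabelling the theaters along a permutation of `ℤ` (used to STATE the permutation symmetries of
Cor. 3.9; the Frobenius-picture itself "does not admit arbitrary permutation symmetries").
[claim: Mochizuki2012, status: disputed] -/
def relabel (σ : Equiv.Perm ℤ) : FrobeniusPicture M := ⟨fun n => Fr.HT (σ n)⟩

/-- Every link of the chain is nonempty (Cor. 3.7 (i)). [claim: Mochizuki2012, status: disputed] -/
theorem link_nonempty (n : ℤ) : (Fr.link n).Nonempty := (Fr.HT n).thetaLink_nonempty _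

/-! ### Corollary 3.9: the étale-picture -/

/-- The edge `ⁿD⊢_v ⥲ ⁽ⁿ⁺¹⁾D⊢_v` of the étale-picture at `v`: the composite poly-isomorphism of
Cor. 3.7 (ii) for the `n`-th Θ-link. [claim: Mochizuki2012, status: disputed] -/
def etaleEdge (v : D.V) (n : ℤ) : PolyIso ((Fr.HT n).Ddash v) ((Fr.HT (n + 1)).Ddash v) :=
  (Fr.HT n).thetaLinkBase (Fr.HT (n + 1)) v

/-- **Corollary 3.9 (i)** (p. 92), the **étale-picture** at `v ∈ V̲`: the `ⁿD_v` (`n ∈ ℤ`) all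
stand in the relationship "— —" to the coric `D⊢_v` (Rmk 3.8.1 (ii), (iii)/(iv): the copies are
"only related to one another via some indeterminate isomorphism"); typed as the poly-isomorphisms
between the `ⁿD⊢_v` generated by composing the Cor. 3.7 (ii) isomorphisms along the chain and their
inverses. [claim: Mochizuki2012, status: disputed] -/
def etalePicture (v : D.V) (a b : ℤ) : PolyIso ((Fr.HT a).Ddash v) ((Fr.HT b).Ddash v) :=
  chainPolyIso (fun n => (Fr.HT n).Ddash v) (Fr.etaleEdge v) a b

/-- Fullness of the étale-picture at `v` (every generated poly-isomorphism is the full one) — a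
statement. [claim: Mochizuki2012, status: disputed] -/
def EtalePictureFull (Fr : FrobeniusPicture M) (v : D.V) : Prop :=
  ∀ a b : ℤ, Fr.etalePicture v a b = PolyIso.full _ _

/-- **Corollary 3.9 (i)**: "the étale-picture [unlike the Frobenius-picture!] admits arbitrary
permutation symmetries among the labels `n ∈ ℤ`" — typed as a statement: relabelling the chain by
any `σ ∈ Perm ℤ` yields the same poly-isomorphisms between the (same) vertices.
[claim: Mochizuki2012, status: disputed] -/
def EtalePermutationSymmetric (Fr : FrobeniusPicture M) (v : D.V) : Prop :=
  ∀ (σ : Equiv.Perm ℤ) (a b : ℤ), (Fr.relabel σ).etalePicture v a b = Fr.etalePicture v (σ a) (σ b)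

/-- If the composite poly-isomorphisms of Cor. 3.7 (ii) are full (its bracketed "[full]") for all
consecutive theaters of the chain, the étale-picture is full — PROVED.
[claim: Mochizuki2012, status: disputed] -/
theorem etalePicture_full (v : D.V)
    (h : ∀ n : ℤ, ThetaHodgeTheater.ThetaLinkBaseFull (Fr.HT n) (Fr.HT (n + 1)) v) :
    Fr.EtalePictureFull v :=
  fun a b => chainPolyIso_eq_full (fun n => h n)
    (fun n => (Fr.HT n).thetaLinkBase_nonempty (Fr.HT (n + 1)) v) a b

/-- If the composite poly-isomorphisms of Cor. 3.7 (ii) are full for all pairs of theaters of the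
model, the étale-picture admits arbitrary permutation symmetries — PROVED ("a sort of canonical
splitting of the Frobenius-picture"). [claim: Mochizuki2012, status: disputed] -/
theorem etalePermutationSymmetric_of_full (v : D.V)
    (h : ∀ HT HT' : ThetaHodgeTheater M, ThetaHodgeTheater.ThetaLinkBaseFull HT HT' v) :
    Fr.EtalePermutationSymmetric v := by
  intro σ a b
  rw [(Fr.relabel σ).etalePicture_full v (fun _ => h _ _) a b, Fr.etalePicture_full v (fun _ => h _ _)]
  rfl

/-- The edge of the **étale-picture plus units** (Cor. 3.9 (ii)): the pair poly-isomorphism of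
Cor. 3.7 (ii)+(iii) for the `n`-th Θ-link. [claim: Mochizuki2012, status: disputed] -/
def etaleEdgeUnits (v : D.V) (n : ℤ) :
    PolyIso (((Fr.HT n).Ddash v, (Fr.HT n).unitsDash v) : M.Base v × M.Units v)
      ((Fr.HT (n + 1)).Ddash v, (Fr.HT (n + 1)).unitsDash v) :=
  (Fr.HT n).thetaLinkPair (Fr.HT (n + 1)) v

/-- **Corollary 3.9 (ii)** (p. 92), the **étale-picture plus units** at `v`: the same diagram with
the coric pair "`D⊢_v ↷ 𝒪^×_{C⊢_v}`", its poly-isomorphisms generated by the pair edges along the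
chain. [claim: Mochizuki2012, status: disputed] -/
def etalePictureUnits (v : D.V) (a b : ℤ) :
    PolyIso (((Fr.HT a).Ddash v, (Fr.HT a).unitsDash v) : M.Base v × M.Units v)
      ((Fr.HT b).Ddash v, (Fr.HT b).unitsDash v) :=
  chainPolyIso (fun n => (((Fr.HT n).Ddash v, (Fr.HT n).unitsDash v) : M.Base v × M.Units v))
    (Fr.etaleEdgeUnits v) a b

/-- **Corollary 3.9 (ii)**: "just as in the case of (i), this diagram admits arbitrary permutation
symmetries among the labels `n ∈ ℤ`" — typed as a statement. [claim: Mochizuki2012, status: disputed] -/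
def EtalePermutationSymmetricUnits (Fr : FrobeniusPicture M) (v : D.V) : Prop :=
  ∀ (σ : Equiv.Perm ℤ) (a b : ℤ),
    (Fr.relabel σ).etalePictureUnits v a b = Fr.etalePictureUnits v (σ a) (σ b)

/-- If the pair edges are full for all pairs of theaters, the étale-picture plus units is full
— PROVED. [claim: Mochizuki2012, status: disputed] -/
theorem etalePictureUnits_full (v : D.V)
    (h : ∀ HT HT' : ThetaHodgeTheater M, HT.thetaLinkPair HT' v = PolyIso.full _ _) (a b : ℤ) :
    Fr.etalePictureUnits v a b = PolyIso.full _ _ :=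
  chainPolyIso_eq_full (edge := Fr.etaleEdgeUnits v) (fun _ => h _ _)
    (fun n => (Fr.HT n).thetaLinkPair_nonempty (Fr.HT (n + 1)) v) a b

/-- If the pair edges are full for all pairs of theaters, the étale-picture plus units is
permutation-symmetric — PROVED. [claim: Mochizuki2012, status: disputed] -/
theorem etalePermutationSymmetricUnits_of_full (v : D.V)
    (h : ∀ HT HT' : ThetaHodgeTheater M, HT.thetaLinkPair HT' v = PolyIso.full _ _) :
    Fr.EtalePermutationSymmetricUnits v := by
  intro σ a b
  rw [(Fr.relabel σ).etalePictureUnits_full v h a b, Fr.etalePictureUnits_full v h]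
  rfl

end FrobeniusPicture

end Pictures

end Literature.IUT.HodgeTheaters
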